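import Summits.BirchSwinnertonDyer.BirchSwinnertonDyer.Theses.EisensteinPrimes
import HarnessLib

/-!
# Route `EisensteinPrimes` (rung K5): the glue of the `PublishedInputs` split

The support item `PublishedInputs` (stmt-BirchSwinnertonDyer-19037; twenty published facts as one
conjunction) was split (gen 1, director-bsd 05:15:22Z K5 staffable remedy, K1/K3 pattern) into
eleven by-name alias children — conjuncts 1, 2, 3, 4, 5, 6, 7, 8, 11, 14, 15, each `def X : Prop :=
<Literature constant>` — and one tail child `PublishedInputsTail` (conjuncts 9, 10, 12, 13, 16, 17,
18, 19, 20 verbatim), with the gate-generated glue item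
`Summit.BirchSwinnertonDyer.BirchSwinnertonDyer.Theses.EisensteinPrimes.PublishedInputsOfParts :=
  CGLSAnticyclotomicControlTorsionFree → BSDQuotientIsogenyInvariance → GVCharIdealEqOfGVPar →
    GreenbergCharValueRankZero → ModularParametrizationSupply → NewformOfEllipticCurve →
    HoffsteinLuoNonvanishingTwist → GrossZagierRationalPointI73 → RankEqAnalyticRankLeOne →
    GVLambdaMuMultiplicative → WuthrichMultiplicativeDivisibilityReducible → PublishedInputsTail →
    PublishedInputs`
(stmt-BirchSwinnertonDyer-19490). This file closes the glue item by reassembling the twenty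
conjuncts in the parent's order; every child unfolds definitionally to the corresponding conjunct,
so the proof is the planner's one-line term (plan-g15/staffable-v1/AliasSketch.lean, farm rc 0).
Nothing is asserted: all twenty facts remain hypotheses. No label or count moves.
[cite: KellerYin2024, Thm A] [cite: GreenbergVatsal2000, Thm 1.3]
-/

set_option autoImplicit false
set_option linter.dupNamespace false

namespace Summit.BirchSwinnertonDyer.BirchSwinnertonDyer.Theorems

open Summit.BirchSwinnertonDyer.BirchSwinnertonDyer.Theses.EisensteinPrimes

/-- **Glue of the `PublishedInputs` split**: the eleven by-name children and the tail child give
back the parent conjunction `PublishedInputs`, conjunct by conjunct in the parent's order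
(children carry conjuncts 1–8, 11, 14, 15; the tail carries 9, 10, 12, 13, 16–20). Pure reassembly;
nothing asserted. [cite: KellerYin2024, Thm A] [cite: GreenbergVatsal2000, Thm 1.3] -/
theorem publishedInputsOfParts_holds :
    Summit.BirchSwinnertonDyer.BirchSwinnertonDyer.Theses.EisensteinPrimes.PublishedInputsOfParts :=
  fun h1 h2 h3 h4 h5 h6 h7 h8 h11 h14 h15 ⟨h9, h10, h12, h13, h16, h17, h18, h19, h20⟩ =>
    ⟨h1, h2, h3, h4, h5, h6, h7, h8, h9, h10, h11, h12, h13, h14, h15, h16, h17, h18, h19, h20⟩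

end Summit.BirchSwinnertonDyer.BirchSwinnertonDyer.Theorems
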